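import Summits.QuantumFields.YangMills.Theorems.BalabanUVNodesN16Thm4Output
import Summits.QuantumFields.BalabanUV.T4Continuum.Spine.NE3.PairLandau138B8
import Literature.MathematicalPhysics.QuantumFieldTheory.Balaban1983to89.B8Thm4TorusAt
import HarnessLib

/-!
# Route «BalabanUVNodes» (cluster K4 «SpineRates»), Track-A DAG node N16 = NE3 — THE N05 → N16 EDGE OF RECORD WITH THE LANDAU MEMBER IN
# N05's OWN LETTER: file 7's OUTPUT binder (OUT) with THE END's variational (1.38) `IsLandauB8 L N k W Z` REPLACED by node N05's concrete
# multiplier-form (1.38) `B8Eq138LandauZd.IsLandau138 L k (Lᵏ)⁻¹ univ (torusLam k) W A` (all-torus geometry), via n16-b's dictionary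
# `PairLandau138B8.isLandauB8_of_isLandau138_torus`

Cell `pub-ymgap`, seat `pub-ymgap-dag-n16-a` (KNIT-BY-NAME, HUMAN RULING D-0062; chair R424 venue), generation 4, file 9.  `bears_on: R4∕N16 · edge N05 → N16`.
Filed `--supports stmt-QuantumFields-19182`.  TRIGGER (ii) of generation 3's HANDOFF («n16-b's `PairLandau138B8` ⇒ replace the `IsLandauB8` residual of (OUT)»)
FIRED with p421552 (`Spine/NE3/PairLandau138B8`, pub-ymgap INBOX l.11005) — consumed here BY NAME.

WHAT.  In file 7 (`BalabanUVNodesN16Thm4Output`, p420891) the N05 → N16 edge is (OUT) = [Balaban1985RegularSpaces] Thm 4's OUTPUT at the minimiser pair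
in print's letters, EXCEPT its Landau member, which was still THE END's variational form `IsLandauB8 L N k W Z` («`Z ⊥ Δ_W N(Q′(W))`»).  Node N05's
Theorem-4 files (`B8Thm4AtLandau138`, seat n05-a) OUTPUT the Landau equation in multiplier form `IsLandau138` («`Δ_W(D*_W A) = Q′(W)ᵀμ`»,
`B8Eq138LandauZd`), and n16-b's `isLandauB8_of_isLandau138_torus` converts multiplier ⇒ variational in the all-torus geometry (`Ω₀ = univ`, `Λ_j =
B8Thm4TorusAt.torusLam k j`, `(N·Lᵏ)`-periodic data, unitary averaged backgrounds).  HERE the edge binder becomes (OUT₁₃₈): (OUT) verbatim with the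
conjunct `IsLandauB8 …` replaced by `IsLandau138 L k (Lᵏ)⁻¹ Set.univ (torusLam k) (rescale L (bavg L U_B)) A` — N05's letter, nothing of THE END's.
§1 `thm4Output_of_thm4OutputLandau138` (any `d`; `L ≥ 2`, `N ≥ 1`; class letter `b` with `512(d+1)(d+4)L²b ≤ 1`, `b + 226(8(d+1)(d+4))²b² < α`, ONE
letter `α` with `C₀α ≤ ⅓`, `2α ≤ c₂′`): (OUT₁₃₈) ⟹ (OUT).  Per pair: `W = rescale L (bavg L U_B)` is unitary and `(N·Lᵏ)`-periodic (`rescale_bavg_mem_sfClass`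
from `Regular b g (k+1) U_B`), its averaged backgrounds `avgIter L W j`, `j ≤ k`, are unitary ([Balaban1985Averaging] Prop. 2 closure,
`B7Prop2Explicit.avgIter_mem` at `pdev W < α·L^{−2k}`), `A` is periodic by (OUT₁₃₈)'s own conjunct; then n16-b's dictionary.
§2 `pairLandauGaugeB8Avg_of_thm4OutputLandau138` (any `d ≥ 1`) = file 7 §1 ∘ §1.
§3 `n16_of_thm4OutputLandau138` (`d = 4`): THE EDGE OF RECORD — `∃ r > 0, ∀ g > 0, ∃ C ≥ 0, ∀ b′ c′` on file 7's three ε-free leaf lines, `∀ 0 < ε ≤ r,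
0 ≤ s₁ ≤ r, 0 ≤ b ≤ ε∕2`, `∀ g′` on the ε-free line `g′ + 2(b′ + 226·320²·b′²)·s₁ ≤ s₁`, `∀ s₂ dom`: (OUT₁₃₈) at `(s₁, g′, s₂, β = 1)` → `LeafH3sup 4 L N ε b′ c′ dom`
→ `NE3EnergyRateWCov 4 (sfClass 4 L N ε) L N b g C s₁ s₂ dom` (= `YMDAG.N16 …`); file 7 §2 ∘ §1 (`r` shrunk by file 7's own radii so that the class letter
`b ≤ ε∕2` meets §1's two lines at the displayed `α₁ = min {1∕(3C₀(4)), c₂′(4,L)∕2}` — `BalabanUVNodesN16Restr129.restrRegime_of_small`).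
§4 `ne3Shape_of_thm4OutputLandau138` (`d = 4`): the DECL column likewise (file 7 §3 ∘ §1).

HONEST FRAMING.  Bookkeeping over LANDED theorems by name; (OUT₁₃₈) is [Balaban1985RegularSpaces] Thm 4∕Thm 2 + Prop 3 OUTPUT TYPE at curved backgrounds,
torus geometry — NOT proved anywhere in the tree (node N05's theorem; its typed existence half `B8Thm4AtLandau138.thm4_exists_leafShape_landau138` has
this head shape on `ℤᵈ` modulo Prop 5 ∕ [4] Thm 3.3 ∕ periodicity ∕ the Prop-3 gradient–Hölder–Laplacian letters); (H3ˢᵘᵖ) = N07's [Balaban1985Variational]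
Thm 1 (8)+(10) TYPE; **N16 ∕ NE3 is NOT discharged**; count-neutral; one finite four-torus at fixed ε — NOT ℝ⁴, NOT infinite volume, NOT OS, NOT a mass
gap, NOT Clay.
-/

set_option autoImplicit false

open scoped BigOperators Matrix Matrix.Norms.L2Operator
open NormedSpace

namespace Summit.QuantumFields.YangMills.BalabanUVNodes.N16

open Literature.MathematicalPhysics.QuantumFieldTheory.Balaban1983to89
open B7Prop1Explicit B7Prop2Explicit
open T4AveragingDeficitWall (IsUnitaryCfg SmallField Ad IsSkewDir vary fineAction blockSites)
open T4AveragingDeficitWallBoundary (IsPeriodicCfg periodBox)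
open T4EtaRateMin (NE3Shape)
open B8Lemma1NonAbelian (pert)
open B7Eq92Concrete (mgauge)
open B8Ineq132 (covDerivFwd)
open B8Eq146AExpansion (iEta)
open B8Eq184Proof (cfgExp)
open B8Eq119TwistedAxial (Restr129)
open B8Eq166ConstraintPair (ptw)
open B8Eq138LandauZd (IsLandau138)
open B8Thm4TorusAt (torusLam)
open Summit.QuantumFields.BalabanUV.T4Continuum
open AveragingDeficitPeriodicCounting (IsPeriodicDir)
open MinimalActionSandwich (IsMinimiser)
open MinimalActionRate (Regular sfClass rescale_bavg_mem_sfClass minActReadings)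
open MinimalActionRefine (RegularSup gradConst)
open BlockAverageCurrent (curConst curConst_nonneg)
open NE3EnergyShapes (IsUnitarySite IsPeriodicSite)
open NE3EnergyWeightedCovShape (NE3EnergyRateWCov)
open NE3RightInverseSupLetters (frameC)
open NE3.PairLandauB8 (LandauRepB8 IsLandauB8 covLapDir)
open NE3.PairLandauB8Avg (PairLandauGaugeB8Avg)
open NE3.LeafIndexSockets (LeafH3sup)
open NE3.SupplierB8SfClassPrep (pdev_le_of_smallField)
open NE3.PairLandau138B8 (isLandauB8_of_isLandau138_torus)

noncomputable section

variable {d : ℕ} {n : Type*} [Fintype n] [DecidableEq n]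

/-! ## §1 (OUT₁₃₈) ⟹ (OUT): the Landau member converted by n16-b's dictionary -/

/-- **(OUT₁₃₈) ⟹ (OUT)** (any `d`; `L ≥ 2`, `N ≥ 1`; class regularity letter `b ≥ 0` with `512(d+1)(d+4)L²b ≤ 1` and `b + 226(8(d+1)(d+4))²b² < α` for ONE
letter `α > 0` with `C₀α ≤ ⅓`, `2α ≤ c₂′` — the averaging regime of [Balaban1985Averaging] Prop. 2, nothing else): Theorem 4's OUTPUT binder at the pair with
node N05's multiplier-form Landau equation `IsLandau138 L k (Lᵏ)⁻¹ univ (torusLam k) W A` IMPLIES file 7's binder with THE END's `IsLandauB8 L N k W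
(Ad_{W⁻¹}(iηA))`, every other conjunct unchanged.  `PairLandau138B8.isLandauB8_of_isLandau138_torus` at `W = rescale L (bavg L U_B)` (unitary, periodic,
`avgIter L W j` unitary by `avgIter_mem`). [folklore] -/
theorem thm4Output_of_thm4OutputLandau138 [Nonempty n] {L N : ℕ} (hL : 2 ≤ L) (hN : 1 ≤ N) {ε b g α s g' s₂ s₃ β : ℝ}
    (hb : 0 ≤ b) (hbs : 512 * (d + 1) * (d + 4) * (L : ℝ) ^ 2 * b ≤ 1)
    (hbα : b + 226 * (8 * (d + 1) * (d + 4)) ^ 2 * b ^ 2 < α)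
    (hα : 0 < α) (hα3 : C0 d * α ≤ 1 / 3) (hα2 : 2 * α ≤ c2' d L)
    {dom : Set (Site d → Fin d → (Matrix n n ℂ)ˣ)}
    (hOut : ∀ k : ℕ, 1 ≤ k → ∀ V ∈ dom, ∀ UA UB : Site d → Fin d → (Matrix n n ℂ)ˣ,
      IsMinimiser d (sfClass d L N ε) L N k V UA → IsMinimiser d (sfClass d L N ε) L N (k + 1) V UB → Regular d L N b g (k + 1) UB →
      ∃ u : Site d → (Matrix n n ℂ)ˣ, (∀ x, u x ∈ unitaryUnits (Matrix n n ℂ)) ∧ IsPeriodicSite u ((N * L ^ k : ℕ) : ℤ) ∧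
        (∃ Λ : ℕ → Set (Site d), Λ k = Set.univ ∧ Restr129 L k Λ (rescale L (bavg L UB)) u) ∧
        ∃ A : Site d → Fin d → Matrix n n ℂ,
          (∀ x μ, IsSelfAdjoint (A x μ)) ∧ (∀ (x : Site d) (κ μ : Fin d), A (x + ((N * L ^ k : ℕ) : ℤ) • e κ) μ = A x μ) ∧
          mgauge (rescale L (bavg L UB)) u (cfgExp (((L : ℝ) ^ k)⁻¹) A)
            = pert (gaugeAct (ptw L (rescale L (bavg L UB)) UA k) UA) (rescale L (bavg L UB)) ∧
          (∀ x μ, ‖A x μ‖ ≤ s) ∧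
          (∀ (μ : Fin d) (x : Site d) (κ : Fin d), ‖covDerivFwd (((L : ℝ) ^ k)⁻¹) (rescale L (bavg L UB)) μ (fun z => A z κ) x‖ ≤ g') ∧
          IsLandau138 L k (((L : ℝ) ^ k)⁻¹) Set.univ (torusLam k) (rescale L (bavg L UB)) A ∧
          (∀ (κ μ : Fin d) (y : Site d),
            ‖Ad (rescale L (bavg L UB) (y + e κ) μ)
                (Ad (rescale L (bavg L UB) (y + e κ + e μ) μ)
                    ((fun x μ => Ad (rescale L (bavg L UB) x μ)⁻¹ (iEta (((L : ℝ) ^ k)⁻¹) A x μ)) (y + (2 : ℕ) • e μ) κ)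
                  - (fun x μ => Ad (rescale L (bavg L UB) x μ)⁻¹ (iEta (((L : ℝ) ^ k)⁻¹) A x μ)) (y + e μ) κ)
              - (Ad (rescale L (bavg L UB) (y + e κ) μ) ((fun x μ => Ad (rescale L (bavg L UB) x μ)⁻¹ (iEta (((L : ℝ) ^ k)⁻¹) A x μ)) (y + e μ) κ)
                - (fun x μ => Ad (rescale L (bavg L UB) x μ)⁻¹ (iEta (((L : ℝ) ^ k)⁻¹) A x μ)) y κ)‖
              ≤ s₂ * (((L : ℝ)⁻¹) ^ k) ^ ((2 : ℝ) + β)) ∧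
          (∀ (x : Site d) (κ : Fin d),
            ‖covLapDir (rescale L (bavg L UB)) (fun x μ => Ad (rescale L (bavg L UB) x μ)⁻¹ (iEta (((L : ℝ) ^ k)⁻¹) A x μ)) x κ‖
              ≤ s₃ * (((L : ℝ)⁻¹) ^ k) ^ 3)) :
    ∀ k : ℕ, 1 ≤ k → ∀ V ∈ dom, ∀ UA UB : Site d → Fin d → (Matrix n n ℂ)ˣ,
      IsMinimiser d (sfClass d L N ε) L N k V UA → IsMinimiser d (sfClass d L N ε) L N (k + 1) V UB → Regular d L N b g (k + 1) UB →
      ∃ u : Site d → (Matrix n n ℂ)ˣ, (∀ x, u x ∈ unitaryUnits (Matrix n n ℂ)) ∧ IsPeriodicSite u ((N * L ^ k : ℕ) : ℤ) ∧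
        (∃ Λ : ℕ → Set (Site d), Λ k = Set.univ ∧ Restr129 L k Λ (rescale L (bavg L UB)) u) ∧
        ∃ A : Site d → Fin d → Matrix n n ℂ,
          (∀ x μ, IsSelfAdjoint (A x μ)) ∧ (∀ (x : Site d) (κ μ : Fin d), A (x + ((N * L ^ k : ℕ) : ℤ) • e κ) μ = A x μ) ∧
          mgauge (rescale L (bavg L UB)) u (cfgExp (((L : ℝ) ^ k)⁻¹) A)
            = pert (gaugeAct (ptw L (rescale L (bavg L UB)) UA k) UA) (rescale L (bavg L UB)) ∧
          (∀ x μ, ‖A x μ‖ ≤ s) ∧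
          (∀ (μ : Fin d) (x : Site d) (κ : Fin d), ‖covDerivFwd (((L : ℝ) ^ k)⁻¹) (rescale L (bavg L UB)) μ (fun z => A z κ) x‖ ≤ g') ∧
          IsLandauB8 L N k (rescale L (bavg L UB)) (fun x μ => Ad (rescale L (bavg L UB) x μ)⁻¹ (iEta (((L : ℝ) ^ k)⁻¹) A x μ)) ∧
          (∀ (κ μ : Fin d) (y : Site d),
            ‖Ad (rescale L (bavg L UB) (y + e κ) μ)
                (Ad (rescale L (bavg L UB) (y + e κ + e μ) μ)
                    ((fun x μ => Ad (rescale L (bavg L UB) x μ)⁻¹ (iEta (((L : ℝ) ^ k)⁻¹) A x μ)) (y + (2 : ℕ) • e μ) κ)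
                  - (fun x μ => Ad (rescale L (bavg L UB) x μ)⁻¹ (iEta (((L : ℝ) ^ k)⁻¹) A x μ)) (y + e μ) κ)
              - (Ad (rescale L (bavg L UB) (y + e κ) μ) ((fun x μ => Ad (rescale L (bavg L UB) x μ)⁻¹ (iEta (((L : ℝ) ^ k)⁻¹) A x μ)) (y + e μ) κ)
                - (fun x μ => Ad (rescale L (bavg L UB) x μ)⁻¹ (iEta (((L : ℝ) ^ k)⁻¹) A x μ)) y κ)‖
              ≤ s₂ * (((L : ℝ)⁻¹) ^ k) ^ ((2 : ℝ) + β)) ∧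
          (∀ (x : Site d) (κ : Fin d),
            ‖covLapDir (rescale L (bavg L UB)) (fun x μ => Ad (rescale L (bavg L UB) x μ)⁻¹ (iEta (((L : ℝ) ^ k)⁻¹) A x μ)) x κ‖
              ≤ s₃ * (((L : ℝ)⁻¹) ^ k) ^ 3) := by
  intro k hk V hV UA UB hA hB hreg
  have hL1 : 1 ≤ L := le_trans (by norm_num) hL
  obtain ⟨u, hu, huP, hres, A, hAsa, hAP, hmg, hs, hg, h138, hhol, hlap⟩ := hOut k hk V hV UA UB hA hB hreg
  -- the background `W = rescale L (bavg L U_B)`: unitary, periodic, small-field of radius `(b + 226(8(d+1)(d+4))²b²)·L^{−2k}`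
  have hαb0 : 0 ≤ b + 226 * (8 * (d + 1) * (d + 4)) ^ 2 * b ^ 2 := by positivity
  obtain ⟨hWu, hWP, hWsm⟩ := rescale_bavg_mem_sfClass hL1 hb hbs le_rfl hreg
  have h33 : pdev (rescale L (bavg L UB)) < α * (((L : ℝ) ^ k)⁻¹) ^ 2 := by
    refine (pdev_le_of_smallField (div_nonneg hαb0 (by positivity)) hWsm).trans_lt ?_
    rw [inv_pow, ← div_eq_mul_inv]; exact div_lt_div_of_pos_right hbα (by positivity)
  -- `A` is periodic (its own conjunct); `η = (Lᵏ)⁻¹ ≠ 0`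
  have hAP' : IsPeriodicDir A ((N * L ^ k : ℕ) : ℤ) := fun x κ μ => hAP x κ μ
  have hη : (((L : ℝ) ^ k)⁻¹) ≠ 0 := by positivity
  -- the averaged backgrounds `Ū^j`, `j ≤ k`, stay unitary ([Balaban1985Averaging] Prop. 2's closure property of the unitary group)
  have hWj : ∀ j, j < k → IsUnitaryCfg (avgIter L (rescale L (bavg L UB)) j) := by
    letI : CStarAlgebra (Matrix n n ℂ) := {}
    have hG := avgClosed_unitaryUnits d (𝔸 := Matrix n n ℂ) L
    intro j hj x κ
    exact avgIter_mem L hL hG k (rescale L (bavg L UB)) hWu hα hα3 hα2 h33 j hj.le x κ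
  -- n16-b's dictionary: multiplier form (N05) ⟹ variational form (THE END), torus geometry (`torusLam k` unfolds to its `if`)
  have hlan : IsLandauB8 (d := d) L N k (rescale L (bavg L UB))
      (fun x μ => Ad (rescale L (bavg L UB) x μ)⁻¹ (iEta (((L : ℝ) ^ k)⁻¹) A x μ)) :=
    isLandauB8_of_isLandau138_torus hL1 hN hη hWu hWP hWj hAP' h138
  exact ⟨u, hu, huP, hres, A, hAsa, hAP, hmg, hs, hg, hlan, hhol, hlap⟩

/-! ## §2 `PairLandauGaugeB8Avg` from (OUT₁₃₈) (any dimension) -/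

/-- **`PairLandauGaugeB8Avg` FROM [B8] THM 4's OUTPUT AT THE PAIR WITH NODE N05's LANDAU LETTER** (`d ≥ 1`, `L ≥ 2`, `N ≥ 1`; letters exactly as in file 7 §1):
(OUT₁₃₈) ∧ (H3ˢᵘᵖ) ⟹ `PairLandauGaugeB8Avg d (sfClass d L N ε) L N b g s₁ s₂ β dom` — file 7's `pairLandauGaugeB8Avg_of_thm4Output` ∘ §1.  No existence is
proved: (OUT₁₃₈) is the hypothesis. [folklore] -/
theorem pairLandauGaugeB8Avg_of_thm4OutputLandau138 [Nonempty n] (hd : 1 ≤ d) {L N : ℕ} (hL : 2 ≤ L) (hN : 1 ≤ N) {ε b g b' c' α s g' s₁ s₂ β : ℝ}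
    (hε : 0 ≤ ε) (hb : 0 ≤ b) (hbs : 512 * (d + 1) * (d + 4) * (L : ℝ) ^ 2 * b ≤ 1)
    (hbα : b + 226 * (8 * (d + 1) * (d + 4)) ^ 2 * b ^ 2 < α)
    (hb' : 0 ≤ b') (hRb : 2 ^ 15 * ((d : ℝ) + 1) ^ 2 * ((d : ℝ) + 4) ^ 2 * (L : ℝ) ^ 2 * b' ≤ 1)
    (hb'α : b' + 226 * (8 * (d + 1) * (d + 4)) ^ 2 * b' ^ 2 < α)
    (hα : 0 < α) (hεα : ε < α) (hα3 : C0 d * α ≤ 1 / 3) (hα2 : 2 * α ≤ c2' d L)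
    (hs0 : 0 ≤ s) (hsup : s ≤ s₁) (hgrad : g' + 2 * (b' + 226 * (8 * (d + 1) * (d + 4)) ^ 2 * b' ^ 2) * s ≤ s₁)
    {dom : Set (Site d → Fin d → (Matrix n n ℂ)ˣ)}
    (hOut : ∀ k : ℕ, 1 ≤ k → ∀ V ∈ dom, ∀ UA UB : Site d → Fin d → (Matrix n n ℂ)ˣ,
      IsMinimiser d (sfClass d L N ε) L N k V UA → IsMinimiser d (sfClass d L N ε) L N (k + 1) V UB → Regular d L N b g (k + 1) UB →
      ∃ u : Site d → (Matrix n n ℂ)ˣ, (∀ x, u x ∈ unitaryUnits (Matrix n n ℂ)) ∧ IsPeriodicSite u ((N * L ^ k : ℕ) : ℤ) ∧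
        (∃ Λ : ℕ → Set (Site d), Λ k = Set.univ ∧ Restr129 L k Λ (rescale L (bavg L UB)) u) ∧
        ∃ A : Site d → Fin d → Matrix n n ℂ,
          (∀ x μ, IsSelfAdjoint (A x μ)) ∧ (∀ (x : Site d) (κ μ : Fin d), A (x + ((N * L ^ k : ℕ) : ℤ) • e κ) μ = A x μ) ∧
          mgauge (rescale L (bavg L UB)) u (cfgExp (((L : ℝ) ^ k)⁻¹) A)
            = pert (gaugeAct (ptw L (rescale L (bavg L UB)) UA k) UA) (rescale L (bavg L UB)) ∧
          (∀ x μ, ‖A x μ‖ ≤ s) ∧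
          (∀ (μ : Fin d) (x : Site d) (κ : Fin d), ‖covDerivFwd (((L : ℝ) ^ k)⁻¹) (rescale L (bavg L UB)) μ (fun z => A z κ) x‖ ≤ g') ∧
          IsLandau138 L k (((L : ℝ) ^ k)⁻¹) Set.univ (torusLam k) (rescale L (bavg L UB)) A ∧
          (∀ (κ μ : Fin d) (y : Site d),
            ‖Ad (rescale L (bavg L UB) (y + e κ) μ)
                (Ad (rescale L (bavg L UB) (y + e κ + e μ) μ)
                    ((fun x μ => Ad (rescale L (bavg L UB) x μ)⁻¹ (iEta (((L : ℝ) ^ k)⁻¹) A x μ)) (y + (2 : ℕ) • e μ) κ)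
                  - (fun x μ => Ad (rescale L (bavg L UB) x μ)⁻¹ (iEta (((L : ℝ) ^ k)⁻¹) A x μ)) (y + e μ) κ)
              - (Ad (rescale L (bavg L UB) (y + e κ) μ) ((fun x μ => Ad (rescale L (bavg L UB) x μ)⁻¹ (iEta (((L : ℝ) ^ k)⁻¹) A x μ)) (y + e μ) κ)
                - (fun x μ => Ad (rescale L (bavg L UB) x μ)⁻¹ (iEta (((L : ℝ) ^ k)⁻¹) A x μ)) y κ)‖
              ≤ s₂ * (((L : ℝ)⁻¹) ^ k) ^ ((2 : ℝ) + β)) ∧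
          (∀ (x : Site d) (κ : Fin d),
            ‖covLapDir (rescale L (bavg L UB)) (fun x μ => Ad (rescale L (bavg L UB) x μ)⁻¹ (iEta (((L : ℝ) ^ k)⁻¹) A x μ)) x κ‖
              ≤ s₁ * (((L : ℝ)⁻¹) ^ k) ^ 3))
    (h3 : LeafH3sup d L N ε b' c' dom) :
    PairLandauGaugeB8Avg d (sfClass d L N ε) L N b g s₁ s₂ β dom :=
  pairLandauGaugeB8Avg_of_thm4Output hd hL hε hb hbs hbα hb' hRb hb'α hα hεα hα3 hα2 hs0 hsup hgrad
    (thm4Output_of_thm4OutputLandau138 hL hN hb hbs hbα hα hα3 hα2 hOut) h3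


/-! ## §3 The `d = 4` record knit over (OUT₁₃₈) — the edge of record on N16's side -/

/-- **N16 · NE3 BY NAME FROM [B8] THM 4's OUTPUT AT THE PAIR (LANDAU MEMBER IN NODE N05's LETTER) AND N07's INTERFACE — THE EDGE OF RECORD ON N16's SIDE**
(`d = 4`; `L ≥ 2`, `N ≥ 1`).  With the DISPLAYED absolute letter `α₁ = min {1∕(3C₀(4)), c₂′(4,L)∕2}`: there is `r > 0` (function of `(L, N, n)`) such that for
every `g > 0` there is ONE `C ≥ 0` (function of `(L, N, n, g)`) such that for all leaf letters `0 ≤ b′, c′` on THREE ε-free lines — (Rb), the `c′`-line,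
`b′ + 226·320²·b′² < α₁` — every `0 < ε ≤ r`, `0 ≤ s₁ ≤ r`, `0 ≤ b ≤ ε∕2`, every gradient letter `g′` on the ε-free line `g′ + 2(b′ + 226·320²·b′²)·s₁ ≤ s₁`, every `s₂`
and `dom`: (OUT₁₃₈) at `(s₁, g′, s₂, β = 1)` → `LeafH3sup 4 L N ε b′ c′ dom` → `NE3EnergyRateWCov 4 (sfClass 4 L N ε) L N b g C s₁ s₂ dom` (= `YMDAG.N16 …`).
File 7's `n16_of_thm4Output` ∘ §1 (`r` shrunk by `α₁∕2` and file 2's four radii so that the class letter meets §1's two lines).  N16 ∕ NE3 NOT proved: (OUT₁₃₈)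
and (H3ˢᵘᵖ) are the hypotheses. [folklore] -/
theorem n16_of_thm4OutputLandau138 [Nonempty n] {L N : ℕ} (hL : 2 ≤ L) (hN : 1 ≤ N) :
    ∃ r : ℝ, 0 < r ∧ ∀ ⦃g : ℝ⦄, 0 < g → ∃ C : ℝ, 0 ≤ C ∧ ∀ ⦃b' c' : ℝ⦄, 0 ≤ b' → 0 ≤ c' →
      2 ^ 15 * ((4 : ℝ) + 1) ^ 2 * ((4 : ℝ) + 4) ^ 2 * (L : ℝ) ^ 2 * b' ≤ 1 →
      23040 * (4 : ℝ) ^ 4 * (frameC 4 L + 4) ^ 3 * (c' + curConst 4 L * b' ^ 2) ≤ 1 →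
      b' + 226 * (8 * ((4 : ℝ) + 1) * ((4 : ℝ) + 4)) ^ 2 * b' ^ 2 < min (1 / (3 * C0 4)) (c2' 4 L / 2) →
      ∀ ⦃ε s₁ b : ℝ⦄, 0 < ε → ε ≤ r → 0 ≤ s₁ → s₁ ≤ r → 0 ≤ b → b ≤ ε / 2 →
      ∀ ⦃g' : ℝ⦄, g' + 2 * (b' + 226 * (8 * ((4 : ℝ) + 1) * ((4 : ℝ) + 4)) ^ 2 * b' ^ 2) * s₁ ≤ s₁ → ∀ (s₂ : ℝ)
      {dom : _root_.Set (Site 4 → Fin 4 → (Matrix n n ℂ)ˣ)},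
        (∀ k : ℕ, 1 ≤ k → ∀ V ∈ dom, ∀ UA UB : Site 4 → Fin 4 → (Matrix n n ℂ)ˣ,
          IsMinimiser 4 (sfClass 4 L N ε) L N k V UA → IsMinimiser 4 (sfClass 4 L N ε) L N (k + 1) V UB → Regular 4 L N b g (k + 1) UB →
          ∃ u : Site 4 → (Matrix n n ℂ)ˣ, (∀ x, u x ∈ unitaryUnits (Matrix n n ℂ)) ∧ IsPeriodicSite u ((N * L ^ k : ℕ) : ℤ) ∧
            (∃ Λ : ℕ → Set (Site 4), Λ k = Set.univ ∧ Restr129 L k Λ (rescale L (bavg L UB)) u) ∧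
            ∃ A : Site 4 → Fin 4 → Matrix n n ℂ,
              (∀ x μ, IsSelfAdjoint (A x μ)) ∧ (∀ (x : Site 4) (κ μ : Fin 4), A (x + ((N * L ^ k : ℕ) : ℤ) • e κ) μ = A x μ) ∧
              mgauge (rescale L (bavg L UB)) u (cfgExp (((L : ℝ) ^ k)⁻¹) A)
                = pert (gaugeAct (ptw L (rescale L (bavg L UB)) UA k) UA) (rescale L (bavg L UB)) ∧
              (∀ x μ, ‖A x μ‖ ≤ s₁) ∧
              (∀ (μ : Fin 4) (x : Site 4) (κ : Fin 4), ‖covDerivFwd (((L : ℝ) ^ k)⁻¹) (rescale L (bavg L UB)) μ (fun z => A z κ) x‖ ≤ g') ∧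
              IsLandau138 L k (((L : ℝ) ^ k)⁻¹) Set.univ (torusLam k) (rescale L (bavg L UB)) A ∧
              (∀ (κ μ : Fin 4) (y : Site 4),
                ‖Ad (rescale L (bavg L UB) (y + e κ) μ)
                    (Ad (rescale L (bavg L UB) (y + e κ + e μ) μ)
                        ((fun x μ => Ad (rescale L (bavg L UB) x μ)⁻¹ (iEta (((L : ℝ) ^ k)⁻¹) A x μ)) (y + (2 : ℕ) • e μ) κ)
                      - (fun x μ => Ad (rescale L (bavg L UB) x μ)⁻¹ (iEta (((L : ℝ) ^ k)⁻¹) A x μ)) (y + e μ) κ)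
                  - (Ad (rescale L (bavg L UB) (y + e κ) μ)
                      ((fun x μ => Ad (rescale L (bavg L UB) x μ)⁻¹ (iEta (((L : ℝ) ^ k)⁻¹) A x μ)) (y + e μ) κ)
                    - (fun x μ => Ad (rescale L (bavg L UB) x μ)⁻¹ (iEta (((L : ℝ) ^ k)⁻¹) A x μ)) y κ)‖
                  ≤ s₂ * (((L : ℝ)⁻¹) ^ k) ^ ((2 : ℝ) + 1)) ∧
              (∀ (x : Site 4) (κ : Fin 4),
                ‖covLapDir (rescale L (bavg L UB)) (fun x μ => Ad (rescale L (bavg L UB) x μ)⁻¹ (iEta (((L : ℝ) ^ k)⁻¹) A x μ)) x κ‖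
                  ≤ s₁ * (((L : ℝ)⁻¹) ^ k) ^ 3)) →
        LeafH3sup 4 L N ε b' c' dom →
        NE3EnergyRateWCov 4 (sfClass 4 L N ε) L N b g C s₁ s₂ dom := by
  have hL1 : 1 ≤ L := by omega
  obtain ⟨r, hr0, hr⟩ := n16_of_thm4Output (n := n) hL hN
  -- the displayed absolute letter `α₁` (pinned axial pre-gauge's regime)
  set α : ℝ := min (1 / (3 * C0 4)) (c2' 4 L / 2) with hαdef
  have hC0 : 0 < C0 4 := C0_pos 4
  have hc2 : 0 < c2' 4 L := c2'_pos 4 L hL1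
  have hα0 : 0 < α := lt_min (by positivity) (by positivity)
  have hα1 : α ≤ 1 / (3 * C0 4) := min_le_left _ _
  have hα2' : α ≤ c2' 4 L / 2 := min_le_right _ _
  -- file 2's four radii at `d = 4`
  obtain ⟨R₁, hR₁⟩ : ∃ R : ℝ, R = 1 / (6 * C0 4 + 1) := ⟨_, rfl⟩
  obtain ⟨R₃, hR₃⟩ : ∃ R : ℝ, R = 1 / (226 * (8 * ((4 : ℝ) + 1) * ((4 : ℝ) + 4)) ^ 2 + 1) := ⟨_, rfl⟩
  obtain ⟨R₄, hR₄⟩ : ∃ R : ℝ, R = 1 / (256 * ((4 : ℝ) + 1) * ((4 : ℝ) + 4) * (L : ℝ) ^ 2 + 1) := ⟨_, rfl⟩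
  have hR₁0 : 0 < R₁ := by rw [hR₁]; positivity
  have hR₃0 : 0 < R₃ := by rw [hR₃]; positivity
  have hR₄0 : 0 < R₄ := by rw [hR₄]; positivity
  refine ⟨min r (min (α / 2) (min R₁ (min (c2' 4 L / 4) (min R₃ R₄)))),
    lt_min hr0 (lt_min (by positivity) (lt_min hR₁0 (lt_min (by positivity) (lt_min hR₃0 hR₄0)))), fun g hg => ?_⟩
  obtain ⟨C, hC0', hC⟩ := hr hg
  refine ⟨C, hC0', fun b' c' hb' hc' hRb hcF hb'α ε s₁ b hε hεr hs₁ hs₁r hb hbh g' hgrad s₂ dom hOut h3 => ?_⟩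
  have hεr' : ε ≤ r := hεr.trans (min_le_left _ _)
  have hεα2 : ε ≤ α / 2 := hεr.trans ((min_le_right _ _).trans (min_le_left _ _))
  have hε1 : ε ≤ R₁ := hεr.trans ((min_le_right _ _).trans ((min_le_right _ _).trans (min_le_left _ _)))
  have hε2 : ε ≤ c2' 4 L / 4 := hεr.trans ((min_le_right _ _).trans ((min_le_right _ _).trans ((min_le_right _ _).trans (min_le_left _ _))))
  have hε3 : ε ≤ R₃ :=
    hεr.trans ((min_le_right _ _).trans ((min_le_right _ _).trans ((min_le_right _ _).trans ((min_le_right _ _).trans (min_le_left _ _)))))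
  have hε4 : ε ≤ R₄ :=
    hεr.trans ((min_le_right _ _).trans ((min_le_right _ _).trans ((min_le_right _ _).trans ((min_le_right _ _).trans (min_le_right _ _)))))
  have hs₁r' : s₁ ≤ r := hs₁r.trans (min_le_left _ _)
  have h1 : (6 * C0 4 + 1) * ε ≤ 1 := by
    rw [hR₁, le_div_iff₀ (by positivity)] at hε1; linarith
  have h2 : 4 * ε ≤ c2' 4 L := by linarith
  have h3' : (226 * (8 * (((4 : ℕ) : ℝ) + 1) * (((4 : ℕ) : ℝ) + 4)) ^ 2 + 1) * ε ≤ 1 := by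
    rw [hR₃, le_div_iff₀ (by positivity)] at hε3; push_cast; linarith
  have h4' : (256 * (((4 : ℕ) : ℝ) + 1) * (((4 : ℕ) : ℝ) + 4) * (L : ℝ) ^ 2 + 1) * ε ≤ 1 := by
    rw [hR₄, le_div_iff₀ (by positivity)] at hε4; push_cast; linarith
  -- the class letter `b` against `α₁`
  obtain ⟨-, -, hbα2, -, -, hbs⟩ := restrRegime_of_small 4 L hε hb hbh h1 h2 h3' h4'
  have hbα : b + 226 * (8 * ((4 : ℕ) + 1 : ℝ) * ((4 : ℕ) + 4 : ℝ)) ^ 2 * b ^ 2 < α := by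
    have : b + 226 * (8 * ((4 : ℕ) + 1 : ℝ) * ((4 : ℕ) + 4 : ℝ)) ^ 2 * b ^ 2 < 2 * ε := by simpa using hbα2
    linarith
  have hA3 : C0 4 * α ≤ 1 / 3 := by
    rw [le_div_iff₀ (by positivity)] at hα1; linarith
  have hA2 : 2 * α ≤ c2' 4 L := by linarith
  exact hC hb' hc' hRb hcF hb'α hε hεr' hs₁ hs₁r' hb hbh hgrad s₂ (thm4Output_of_thm4OutputLandau138 hL hN hb hbs hbα hα0 hA3 hA2 hOut) h3

/-! ## §4 The DECL column over (OUT₁₃₈) -/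

/-- **N16 · THE ROW's DECL `T4EtaRateMin.NE3Shape` FROM [B8] THM 4's OUTPUT AT THE PAIR (LANDAU MEMBER IN NODE N05's LETTER) AND N07's INTERFACE** (`d = 4`;
`L ≥ 2`, `N ≥ 1`; `α₁` as in §3) — file 7's `ne3Shape_of_thm4Output` (its numeric regime verbatim; N05's regularity letter `g := gradConst 4 c`) with (OUT)
replaced by (OUT₁₃₈) at `(s₁, g′, s₂, β = 1)`; conclusion verbatim (a regular selection exists; for every such selection `∃ C′ ≥ 0, NE3Shape (minActReadings …)
C′ (L⁻¹)`).  File 7 §3 ∘ §1.  N16 ∕ NE3 NOT proved. [folklore] -/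
theorem ne3Shape_of_thm4OutputLandau138 [Nonempty n] {L N : ℕ} (hL : 2 ≤ L) (hN : 1 ≤ N) :
    ∃ r : ℝ, 0 < r ∧ ∀ ⦃ε s₁ t b c ε₁ : ℝ⦄, 0 < ε → ε ≤ r → 0 ≤ s₁ → s₁ ≤ r →
      0 ≤ b → b ≤ t → 0 < c → c ≤ t →
      (2 : ℝ) ^ 91 * (L : ℝ) ^ 17 * t ≤ 1 → (2 : ℝ) ^ 76 * (L : ℝ) ^ 12 * t ≤ ε →
      16 * C0 4 * ε ≤ 3 → 1024 * (4 + 1) * (4 + 4) * (L : ℝ) ^ 2 * ε ≤ 1 → b ≤ ε / 2 →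
      23040 * (4 : ℝ) ^ 4 * (frameC 4 L + 4) ^ 3 * (c + curConst 4 L * b ^ 2) ≤ 1 →
      b + 226 * (8 * ((4 : ℝ) + 1) * ((4 : ℝ) + 4)) ^ 2 * b ^ 2 < min (1 / (3 * C0 4)) (c2' 4 L / 2) →
      ε₁ ≤ 1 / 4 → ε₁ ≤ b → 4 * ε₁ ≤ c →
      ∀ ⦃g' : ℝ⦄, g' + 2 * (b + 226 * (8 * ((4 : ℝ) + 1) * ((4 : ℝ) + 4)) ^ 2 * b ^ 2) * s₁ ≤ s₁ → ∀ (s₂ : ℝ)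
      {dom : Set (Site 4 → Fin 4 → (Matrix n n ℂ)ˣ)}, dom ⊆ sfClass 4 L N ε₁ 0 →
        (∀ k : ℕ, 1 ≤ k → ∀ V ∈ dom, ∀ UA UB : Site 4 → Fin 4 → (Matrix n n ℂ)ˣ,
          IsMinimiser 4 (sfClass 4 L N ε) L N k V UA → IsMinimiser 4 (sfClass 4 L N ε) L N (k + 1) V UB → Regular 4 L N b (gradConst 4 c) (k + 1) UB →
          ∃ u : Site 4 → (Matrix n n ℂ)ˣ, (∀ x, u x ∈ unitaryUnits (Matrix n n ℂ)) ∧ IsPeriodicSite u ((N * L ^ k : ℕ) : ℤ) ∧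
            (∃ Λ : ℕ → Set (Site 4), Λ k = Set.univ ∧ Restr129 L k Λ (rescale L (bavg L UB)) u) ∧
            ∃ A : Site 4 → Fin 4 → Matrix n n ℂ,
              (∀ x μ, IsSelfAdjoint (A x μ)) ∧ (∀ (x : Site 4) (κ μ : Fin 4), A (x + ((N * L ^ k : ℕ) : ℤ) • e κ) μ = A x μ) ∧
              mgauge (rescale L (bavg L UB)) u (cfgExp (((L : ℝ) ^ k)⁻¹) A)
                = pert (gaugeAct (ptw L (rescale L (bavg L UB)) UA k) UA) (rescale L (bavg L UB)) ∧
              (∀ x μ, ‖A x μ‖ ≤ s₁) ∧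
              (∀ (μ : Fin 4) (x : Site 4) (κ : Fin 4), ‖covDerivFwd (((L : ℝ) ^ k)⁻¹) (rescale L (bavg L UB)) μ (fun z => A z κ) x‖ ≤ g') ∧
              IsLandau138 L k (((L : ℝ) ^ k)⁻¹) Set.univ (torusLam k) (rescale L (bavg L UB)) A ∧
              (∀ (κ μ : Fin 4) (y : Site 4),
                ‖Ad (rescale L (bavg L UB) (y + e κ) μ)
                    (Ad (rescale L (bavg L UB) (y + e κ + e μ) μ)
                        ((fun x μ => Ad (rescale L (bavg L UB) x μ)⁻¹ (iEta (((L : ℝ) ^ k)⁻¹) A x μ)) (y + (2 : ℕ) • e μ) κ)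
                      - (fun x μ => Ad (rescale L (bavg L UB) x μ)⁻¹ (iEta (((L : ℝ) ^ k)⁻¹) A x μ)) (y + e μ) κ)
                  - (Ad (rescale L (bavg L UB) (y + e κ) μ)
                      ((fun x μ => Ad (rescale L (bavg L UB) x μ)⁻¹ (iEta (((L : ℝ) ^ k)⁻¹) A x μ)) (y + e μ) κ)
                    - (fun x μ => Ad (rescale L (bavg L UB) x μ)⁻¹ (iEta (((L : ℝ) ^ k)⁻¹) A x μ)) y κ)‖
                  ≤ s₂ * (((L : ℝ)⁻¹) ^ k) ^ ((2 : ℝ) + 1)) ∧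
              (∀ (x : Site 4) (κ : Fin 4),
                ‖covLapDir (rescale L (bavg L UB)) (fun x μ => Ad (rescale L (bavg L UB) x μ)⁻¹ (iEta (((L : ℝ) ^ k)⁻¹) A x μ)) x κ‖
                  ≤ s₁ * (((L : ℝ)⁻¹) ^ k) ^ 3)) →
        LeafH3sup 4 L N ε b c dom →
        (∃ sel : ℕ → (Site 4 → Fin 4 → (Matrix n n ℂ)ˣ) → (Site 4 → Fin 4 → (Matrix n n ℂ)ˣ),
            ∀ V ∈ dom, ∀ k : ℕ, IsMinimiser 4 (sfClass 4 L N ε) L N k V (sel k V) ∧ RegularSup 4 L N b c k (sel k V)) ∧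
        ∀ sel : ℕ → (Site 4 → Fin 4 → (Matrix n n ℂ)ˣ) → (Site 4 → Fin 4 → (Matrix n n ℂ)ˣ),
          (∀ V ∈ dom, ∀ k : ℕ, IsMinimiser 4 (sfClass 4 L N ε) L N k V (sel k V)) →
          (∀ V ∈ dom, ∀ k : ℕ, RegularSup 4 L N b c k (sel k V)) →
          ∃ C' : ℝ, 0 ≤ C' ∧
            NE3Shape
              (minActReadings 4 (sfClass 4 L N ε) L N dom
                (fun k V (x : ↥(periodBox (d := 4) N)) =>
                  fineAction (sel k V) (((blockSites L)^[k] {(x : Site 4)}) ×ˢ Finset.univ)))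
              C' ((L : ℝ)⁻¹) := by
  have hL1 : 1 ≤ L := by omega
  obtain ⟨r, hr0, hr⟩ := ne3Shape_of_thm4Output (n := n) hL hN
  set α : ℝ := min (1 / (3 * C0 4)) (c2' 4 L / 2) with hαdef
  have hC0 : 0 < C0 4 := C0_pos 4
  have hc2 : 0 < c2' 4 L := c2'_pos 4 L hL1
  have hα0 : 0 < α := lt_min (by positivity) (by positivity)
  have hα1 : α ≤ 1 / (3 * C0 4) := min_le_left _ _
  have hα2' : α ≤ c2' 4 L / 2 := min_le_right _ _
  obtain ⟨R₁, hR₁⟩ : ∃ R : ℝ, R = 1 / (6 * C0 4 + 1) := ⟨_, rfl⟩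
  obtain ⟨R₃, hR₃⟩ : ∃ R : ℝ, R = 1 / (226 * (8 * ((4 : ℝ) + 1) * ((4 : ℝ) + 4)) ^ 2 + 1) := ⟨_, rfl⟩
  obtain ⟨R₄, hR₄⟩ : ∃ R : ℝ, R = 1 / (256 * ((4 : ℝ) + 1) * ((4 : ℝ) + 4) * (L : ℝ) ^ 2 + 1) := ⟨_, rfl⟩
  have hR₁0 : 0 < R₁ := by rw [hR₁]; positivity
  have hR₃0 : 0 < R₃ := by rw [hR₃]; positivity
  have hR₄0 : 0 < R₄ := by rw [hR₄]; positivity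
  refine ⟨min r (min (α / 2) (min R₁ (min (c2' 4 L / 4) (min R₃ R₄)))),
    lt_min hr0 (lt_min (by positivity) (lt_min hR₁0 (lt_min (by positivity) (lt_min hR₃0 hR₄0)))),
    fun ε s₁ t b c ε₁ hε hεr hs₁ hs₁r hb hbt hc hct hsmall hεt hε1 hε2 hbε hcF hbα' hε₁ hε₁b hε₁c g' hgrad s₂ dom hdom hOut h3 => ?_⟩
  have hεr' : ε ≤ r := hεr.trans (min_le_left _ _)
  have hεα2 : ε ≤ α / 2 := hεr.trans ((min_le_right _ _).trans (min_le_left _ _))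
  have hεR1 : ε ≤ R₁ := hεr.trans ((min_le_right _ _).trans ((min_le_right _ _).trans (min_le_left _ _)))
  have hεR2 : ε ≤ c2' 4 L / 4 := hεr.trans ((min_le_right _ _).trans ((min_le_right _ _).trans ((min_le_right _ _).trans (min_le_left _ _))))
  have hεR3 : ε ≤ R₃ :=
    hεr.trans ((min_le_right _ _).trans ((min_le_right _ _).trans ((min_le_right _ _).trans ((min_le_right _ _).trans (min_le_left _ _)))))
  have hεR4 : ε ≤ R₄ :=
    hεr.trans ((min_le_right _ _).trans ((min_le_right _ _).trans ((min_le_right _ _).trans ((min_le_right _ _).trans (min_le_right _ _)))))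
  have hs₁r' : s₁ ≤ r := hs₁r.trans (min_le_left _ _)
  have h1 : (6 * C0 4 + 1) * ε ≤ 1 := by
    rw [hR₁, le_div_iff₀ (by positivity)] at hεR1; linarith
  have h2 : 4 * ε ≤ c2' 4 L := by linarith
  have h3' : (226 * (8 * (((4 : ℕ) : ℝ) + 1) * (((4 : ℕ) : ℝ) + 4)) ^ 2 + 1) * ε ≤ 1 := by
    rw [hR₃, le_div_iff₀ (by positivity)] at hεR3; push_cast; linarith
  have h4' : (256 * (((4 : ℕ) : ℝ) + 1) * (((4 : ℕ) : ℝ) + 4) * (L : ℝ) ^ 2 + 1) * ε ≤ 1 := by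
    rw [hR₄, le_div_iff₀ (by positivity)] at hεR4; push_cast; linarith
  obtain ⟨-, -, hbα2, -, -, hbs⟩ := restrRegime_of_small 4 L hε hb hbε h1 h2 h3' h4'
  have hbα : b + 226 * (8 * ((4 : ℕ) + 1 : ℝ) * ((4 : ℕ) + 4 : ℝ)) ^ 2 * b ^ 2 < α := by
    have : b + 226 * (8 * ((4 : ℕ) + 1 : ℝ) * ((4 : ℕ) + 4 : ℝ)) ^ 2 * b ^ 2 < 2 * ε := by simpa using hbα2
    linarith
  have hA3 : C0 4 * α ≤ 1 / 3 := by
    rw [le_div_iff₀ (by positivity)] at hα1; linarith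
  have hA2 : 2 * α ≤ c2' 4 L := by linarith
  exact hr hε hεr' hs₁ hs₁r' hb hbt hc hct hsmall hεt hε1 hε2 hbε hcF hbα' hε₁ hε₁b hε₁c hgrad s₂ hdom
    (thm4Output_of_thm4OutputLandau138 hL hN hb hbs hbα hα0 hA3 hA2 hOut) h3

end

end Summit.QuantumFields.YangMills.BalabanUVNodes.N16
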